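import Literature.Probability.RandomPlanarGeometry.RootedLoopFill
import Literature.Probability.RandomPlanarGeometry.BubbleHittingMass
import Literature.Probability.Process.BrownianLoopHitting4
import Literature.Probability.Process.HittingFrom
import HarnessLib

/-!
# The lifted Brownian loop is almost surely a rooted loop in `ℍ`; existence of the Brownian bubble measure

Proof-only file (no definition, no named fact; discharges `exists_isBrownianBubbleMeasure`), after

* G. F. Lawler, O. Schramm, W. Werner, *Conformal restriction: the chordal case*, J. Amer.
  Math. Soc. **16** (2003) 917–955, arXiv:math/0209343 (**[LSW]**), §7.1 (pp. 27–28), second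
  bullet: the Brownian bubble measure at `0` is `μ = c Υ(T^{-1/2} n ⊗ P)`, `Υ : (b, e) ↦ fill(Z)`,
  `Z(t) = T^{1/2} b(t/T) + i e_t` (a Brownian bridge `b` and an independent Itô excursion `e` of
  lifetime `T`), and §4 p. 16 ("a three-dimensional Bessel process is the modulus of a
  three-dimensional Brownian motion"), with (7.2) `μ[K ∩ A ≠ ∅] = −S g_A(0)/6` for `A ∈ 𝒬*`.

The tree realises `T^{-1/2} n ⊗ P` lifted to `ℝ⁴` as the loop measure
`loopBase = 𝟙_{T>0} dT/(2T²) ⊗ wienerQuad` carried by the Brownian loop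
`quadLoop T ω s = W_s − (s/T) W_T` of the four-dimensional Brownian motion `W = brownianQuad`
(`Process/BrownianLoopDensity4`, with its `h`-transform density `lintegral_loopBase_eq`), the
planar loop being `Z_s = exPt (quadLoop T ω s) = L⁰_s + i|L⃗_s|`. This file supplies the two
deterministic-looking inputs of the assembly `exists_isBrownianBubbleMeasure_of_loopProcess`
(`RootedLoopFill`) for THIS loop, so that the Brownian bubble measure exists as soon as the
hitting masses of the lifted loop are known:

* `loopBase_exists_exRad_eq_zero` — **the loop does not return to the axis before its
  lifetime**: `loopBase{∃ s ∈ (0, T), |L⃗_s| = 0} = 0`. For rational `0 < ε ≤ t`, the event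
  "`T > t` and the loop is on the axis at a time of `[ε, t]`" is, through the density on `𝓕_t`
  (`lintegral_loopBase_eq`, applied to the countable description of the hit event,
  `Process.exists_mem_Icc_mem_iff_forall_exists_infDist_lt`), the `|W_t|⁻²`-weighted
  probability that `W` is on the axis at a time of `[ε, t]`, which vanishes (the axis is polar,
  `Process.IsBrownianVec.measure_exists_spRad_eq_zero_of_le`); no time reversal is needed since
  every bad time `s < T` lies in some rational window `[ε, t]` with `t < T`;
* `ae_isRootedLoop_loopBase` — hence **`loopBase`-almost every `(T, ω)` gives a rooted loop
  `s ↦ exPt (quadLoop T ω s)` of duration `T`** (`IsRootedLoop`: continuous, `T > 0`, `0` at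
  `0` and at `T`, in `ℍ` in between), with measurable duration and marginals
  (`measurable_exPt_quadLoop`);
* `exists_isBrownianBubbleMeasure_of_loopBase_hit` — therefore, if
  `loopBase{∃ s ≤ T, exPt (quadLoop T ω s) ∈ A} = starBubbleMass A (= −SΦ_A(0)/6)` for every
  `A ∈ 𝒬*`, then `exists_isBrownianBubbleMeasure`; with the image measure and its measurable
  `Ω_b`-valued bubble map recorded (`isBrownianBubbleMeasure_map_loopBase`);
* `loopBase_hit_eq_starBubbleMass` — **[LSW] (7.2) for the lifted loop**: that hitting identity
  holds, by the tree's `Process.loopBase_loopHits_eq` (`BrownianLoopHitting4`: the loop measure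
  hits the closed lifted hull `exPt⁻¹ A`, bounded and off the ball `|v| < r` about the origin,
  with mass `E[𝟙{τ < ∞}|W_τ|⁻²]`) and `lintegral_bubbleHit_eq` (`BubbleHittingMass`:
  `E[𝟙{τ < ∞}|W_τ|⁻²] = starBubbleMass A`, optional stopping for the harmonic function of
  `BubbleHittingHarmonic`), the two hit events `{∃ s ≤ T}` and `{∃ s < T}` agreeing because the
  loop is at `0 ∉ A` at time `T`;
* **`exists_isBrownianBubbleMeasure_holds`** — DISCHARGE of the named fact
  `exists_isBrownianBubbleMeasure` ([LSW] §7.1: the Brownian bubble measure at `0` exists, as the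
  law of the filled Brownian loop), and `exists_isBrownianBubbleMeasure_map_loopBase` (the
  measure itself: the image of `loopBase` under the bubble map).

## References

* [LSW] §7.1 (pp. 27–28), second bullet, eq. (7.2); §4 p. 16. [LawlerSchrammWerner2003Restriction]
* J.-F. Le Gall, *Brownian Motion, Martingales, and Stochastic Calculus*, GTM 274 (2016), Ch. 7
  Prop. 7.16 (points are polar for Brownian motion in `d ≥ 2`; here the axis of `ℝ⁴ = ℝ × ℝ³`).
  [Legall2016]
-/

noncomputable section

open Set Filter Topology Metric Complex MeasureTheory
open UpperHalfPlane (upperHalfPlaneSet)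
open Literature.Probability.Process
open scoped NNReal ENNReal

namespace Literature.Probability.RandomPlanarGeometry

/-! ### The loop path: continuity, endpoints, measurability -/

/-- The Brownian loop starts at `0`. [folklore] -/
@[simp] theorem quadLoop_zero (T : ℝ) (ω : WienerQuad) : quadLoop T ω 0 = 0 := by
  simp [quadLoop, isBrownianVec_brownianQuad.apply_zero]

/-- The Brownian loop of duration `T > 0` ends at `0` at time `T`. [folklore] -/
theorem quadLoop_end {T : ℝ} (hT : 0 < T) (ω : WienerQuad) : quadLoop T ω T.toNNReal = 0 := by
  simp [quadLoop, Real.coe_toNNReal _ hT.le, div_self hT.ne']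

/-- The marginals of the loop are jointly measurable in (duration, sample). [folklore] -/
theorem measurable_quadLoop_apply (s : ℝ≥0) : Measurable fun p : ℝ × WienerQuad ↦ quadLoop p.1 p.2 s := by
  have h1 : Measurable fun p : ℝ × WienerQuad ↦ brownianQuad s p.2 :=
    (measurable_brownianQuad _).comp measurable_snd
  have h2 : Measurable fun p : ℝ × WienerQuad ↦ brownianQuad p.1.toNNReal p.2 :=
    measurable_uncurry_brownianQuad.comp ((measurable_real_toNNReal.comp measurable_fst).prodMk measurable_snd)
  have h3 : Measurable fun p : ℝ × WienerQuad ↦ ((s : ℝ≥0) : ℝ) / p.1 := measurable_const.div measurable_fst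
  exact h1.sub (h3.smul h2)

/-- The marginals of the planar loop `Z_s = exPt (L_s)` are measurable. [folklore] -/
theorem measurable_exPt_quadLoop (s : ℝ≥0) :
    Measurable fun p : ℝ × WienerQuad ↦ exPt (quadLoop p.1 p.2 s) :=
  continuous_exPt.measurable.comp (measurable_quadLoop_apply s)

/-! ### The loop does not return to the axis before its lifetime -/

/-- The axis `{|w| = 0}` of `ℝ⁴`, a closed nonempty set. [folklore] -/
theorem isClosed_exRad_zero : IsClosed {v : Fin 4 → ℝ | exRad v = 0} :=
  isClosed_eq continuous_exRad continuous_const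

/-- **On the axis at a time of `[ε, t]` with `T > t` is `loopBase`-null** (`0 < ε`, `0 < t`): by
the density `|W_t|⁻²` of the loop measure on `𝓕_t` this is a weighted probability that the
four-dimensional Brownian motion is on the axis at a time `≥ ε`, which is zero.
[cite: LawlerSchrammWerner2003Restriction, §7.1 (p. 28, second bullet) with Legall2016 Ch. 7 Prop. 7.16] -/
theorem loopBase_exists_mem_Icc_exRad_eq_zero {ε t : ℝ≥0} (hε : 0 < ε) (ht : 0 < t) :
    loopBase {p : ℝ × WienerQuad | (t : ℝ) < p.1 ∧
      ∃ s : ℝ≥0, ε ≤ s ∧ s ≤ t ∧ exRad (quadLoop p.1 p.2 s) = 0} = 0 := by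
  classical
  set axis : Set (Fin 4 → ℝ) := {v | exRad v = 0} with haxis
  have haxc : IsClosed axis := isClosed_exRad_zero
  have haxne : axis.Nonempty := ⟨0, by simp [haxis, exRad]⟩
  -- a countable dense set of times in `[0, t]`
  obtain ⟨D, hDc, hDd⟩ : ∃ D : Set (Iic t), D.Countable ∧ Dense D := TopologicalSpace.exists_countable_dense _
  set t₀ : Iic t := ⟨t, mem_Iic.2 le_rfl⟩ with ht₀
  -- the countably described hit event on path space over `[0, t]`
  set PX : Set (Set.Iic t → Fin 4 → ℝ) := {f | ∀ n : ℕ, ∃ q ∈ insert t₀ D,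
    ((ε : ℝ≥0) : WithTop ℝ≥0) ≤ (((q : Iic t) : ℝ≥0) : WithTop ℝ≥0) ∧
      infDist (f q) axis < 1 / ((n : ℝ) + 1)} with hPX
  have hPXm : MeasurableSet PX := by
    have hrepr : PX = ⋂ n : ℕ, ⋃ q ∈ insert t₀ D, {f : Set.Iic t → Fin 4 → ℝ |
        ((ε : ℝ≥0) : WithTop ℝ≥0) ≤ (((q : Iic t) : ℝ≥0) : WithTop ℝ≥0) ∧
          infDist (f q) axis < 1 / ((n : ℝ) + 1)} := by
      ext f
      simp only [hPX, mem_setOf_eq, mem_iInter, mem_iUnion, exists_prop]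
    rw [hrepr]
    refine MeasurableSet.iInter fun n ↦ MeasurableSet.biUnion (hDc.insert _) fun q _ ↦ ?_
    exact (MeasurableSet.const _).inter (measurableSet_lt
      ((continuous_infDist_pt _).measurable.comp (measurable_pi_apply q)) measurable_const)
  -- for a continuous path, `PX` is the hit event on `[ε, t]`
  have hPXiff : ∀ g : ℝ≥0 → (Fin 4 → ℝ), Continuous g →
      ((fun q : Iic t ↦ g q) ∈ PX ↔ ∃ s : ℝ≥0, ε ≤ s ∧ s ≤ t ∧ g s ∈ axis) := by
    intro g hg
    have key := exists_mem_Icc_mem_iff_forall_exists_infDist_lt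
      (u := fun s (_ : Unit) ↦ g s) (T := fun _ ↦ ((ε : ℝ≥0) : WithTop ℝ≥0)) (ω := ())
      haxc haxne hg hDd
    constructor
    · intro h
      obtain ⟨j, hjt, hεj, hj⟩ := key.2 h
      exact ⟨j, WithTop.coe_le_coe.1 hεj, hjt, hj⟩
    · rintro ⟨s, hεs, hst, hs⟩
      exact key.1 ⟨s, hst, WithTop.coe_le_coe.2 hεs, hs⟩
  -- the density identity for `F = 𝟙_PX`
  set F : (Set.Iic t → Fin 4 → ℝ) → ℝ≥0∞ := PX.indicator fun _ ↦ 1 with hF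
  have hFm : Measurable F := measurable_const.indicator hPXm
  have hdens := lintegral_loopBase_eq ht hFm
  -- the right-hand side vanishes: `W` is a.s. off the axis after time `ε`
  have hrhs : ∫⁻ ω, F (vecPast brownianQuad t ω) * newtonFour (brownianQuad t ω) ∂wienerQuad = 0 := by
    have hnull := isBrownianVec_brownianQuad.measure_exists_spRad_eq_zero_of_le 0 hε.ne'
    have hae : ∀ᵐ ω ∂wienerQuad, ω ∉ {ω | ∃ s, ε ≤ s ∧ spRad (0 + brownianQuad s ω) = 0} :=
      measure_eq_zero_iff_ae_notMem.1 hnull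
    rw [← lintegral_zero (μ := wienerQuad)]
    refine lintegral_congr_ae ?_
    filter_upwards [hae] with ω hω
    have hnot : vecPast brownianQuad t ω ∉ PX := by
      intro hmem
      have h' : (fun q : Iic t ↦ brownianQuad q ω) ∈ PX := hmem
      obtain ⟨s, hεs, -, hs⟩ := (hPXiff (fun s ↦ brownianQuad s ω)
        (isBrownianVec_brownianQuad.continuous_path ω)).1 h'
      exact hω ⟨s, hεs, by rw [zero_add]; exact hs⟩
    simp only [hF, indicator_of_notMem hnot, zero_mul]
  rw [hrhs] at hdens
  -- hence the integrand on the left vanishes a.e.; it is `1` on our event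
  have hGm : Measurable fun p : ℝ × WienerQuad ↦
      (Ioi (t : ℝ)).indicator (fun _ ↦ (1 : ℝ≥0∞)) p.1 * F (quadLoopPast t p) :=
    ((measurable_const.indicator measurableSet_Ioi).comp measurable_fst).mul
      (hFm.comp (measurable_quadLoopPast t))
  have hae := (lintegral_eq_zero_iff hGm).1 hdens
  have hnull : loopBase {p : ℝ × WienerQuad |
      ¬ (Ioi (t : ℝ)).indicator (fun _ ↦ (1 : ℝ≥0∞)) p.1 * F (quadLoopPast t p) = 0} = 0 :=
    ae_iff.1 hae
  refine measure_mono_null (fun p hp ↦ ?_) hnull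
  obtain ⟨hpt, s, hεs, hst, hs⟩ := hp
  have hmem : quadLoopPast t p ∈ PX :=
    (hPXiff (quadLoop p.1 p.2) (continuous_quadLoop p.1 p.2)).2 ⟨s, hεs, hst, hs⟩
  simp only [mem_setOf_eq, indicator_of_mem (show p.1 ∈ Ioi (t : ℝ) from hpt), hF,
    indicator_of_mem hmem, one_mul, one_ne_zero, not_false_eq_true]

/-- **The Brownian loop does not return to the axis before its lifetime**:
`loopBase{∃ s ∈ (0, T), |L⃗_s| = 0} = 0` (every bad time lies in a rational window `[ε, t]`
with `t < T`). [cite: LawlerSchrammWerner2003Restriction, §7.1 (p. 28, second bullet) with Legall2016 Ch. 7 Prop. 7.16] -/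
theorem loopBase_exists_exRad_eq_zero :
    loopBase {p : ℝ × WienerQuad | ∃ s : ℝ≥0, 0 < s ∧ (s : ℝ) < p.1 ∧
      exRad (quadLoop p.1 p.2 s) = 0} = 0 := by
  set E : ℚ → ℚ → Set (ℝ × WienerQuad) := fun ε t ↦
    if 0 < ε ∧ 0 < t then {p | (((t : ℝ).toNNReal : ℝ≥0) : ℝ) < p.1 ∧ ∃ s : ℝ≥0, (ε : ℝ).toNNReal ≤ s ∧
      s ≤ (t : ℝ).toNNReal ∧ exRad (quadLoop p.1 p.2 s) = 0} else ∅ with hE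
  have hEnull : ∀ ε t, loopBase (E ε t) = 0 := by
    intro ε t
    by_cases h : 0 < ε ∧ 0 < t
    · simp only [hE, if_pos h]
      exact loopBase_exists_mem_Icc_exRad_eq_zero (Real.toNNReal_pos.2 (by exact_mod_cast h.1))
        (Real.toNNReal_pos.2 (by exact_mod_cast h.2))
    · simp only [hE, if_neg h, measure_empty]
  refine measure_mono_null ?_ (measure_iUnion_null fun ε ↦ measure_iUnion_null fun t ↦ hEnull ε t)
  rintro p ⟨s, hs0, hsT, hs⟩
  have hs0' : (0 : ℝ) < s := by exact_mod_cast hs0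
  obtain ⟨t, hst, htT⟩ := exists_rat_btwn hsT
  obtain ⟨ε, hε0, hεs⟩ := exists_rat_btwn hs0'
  have ht0 : (0 : ℝ) < t := hs0'.trans hst
  refine mem_iUnion.2 ⟨ε, mem_iUnion.2 ⟨t, ?_⟩⟩
  have hcond : 0 < ε ∧ 0 < t := ⟨by exact_mod_cast hε0, by exact_mod_cast ht0⟩
  simp only [hE, if_pos hcond, mem_setOf_eq]
  refine ⟨by rwa [Real.coe_toNNReal _ ht0.le], s, ?_, ?_, hs⟩
  · rw [← NNReal.coe_le_coe, Real.coe_toNNReal _ hε0.le]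
    exact hεs.le
  · rw [← NNReal.coe_le_coe, Real.coe_toNNReal _ ht0.le]
    exact hst.le

/-! ### Almost every lifted loop is a rooted loop in `ℍ` -/

/-- `loopBase`-almost every duration is positive. [folklore] -/
theorem ae_fst_pos_loopBase : ∀ᵐ p : ℝ × WienerQuad ∂loopBase, 0 < p.1 := by
  have h0 : loopTimeMeasure (Iic 0) = 0 := by
    rw [loopTimeMeasure, withDensity_apply _ measurableSet_Iic, Measure.restrict_restrict measurableSet_Iic,
      Iic_inter_Ioi, Ioc_self, Measure.restrict_empty, lintegral_zero_measure]
  have h1 : ∀ᵐ T : ℝ ∂loopTimeMeasure, 0 < T := by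
    filter_upwards [measure_eq_zero_iff_ae_notMem.1 h0] with T hT
    exact not_le.1 hT
  exact (Measure.quasiMeasurePreserving_fst (μ := loopTimeMeasure) (ν := wienerQuad)).ae h1

/-- **`loopBase`-almost every `(T, ω)` gives a rooted loop**: the planar loop
`s ↦ exPt (quadLoop T ω s)` is continuous, has duration `T > 0`, starts and ends at `0`, and
lies in `ℍ` at the times of `(0, T)` (the loop is off the axis there).
[cite: LawlerSchrammWerner2003Restriction, §7.1 (p. 28, second bullet)] -/
theorem ae_isRootedLoop_loopBase :
    ∀ᵐ p : ℝ × WienerQuad ∂loopBase, IsRootedLoop (fun s ↦ exPt (quadLoop p.1 p.2 s)) p.1.toNNReal := by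
  have hax : ∀ᵐ p : ℝ × WienerQuad ∂loopBase,
      p ∉ {p : ℝ × WienerQuad | ∃ s : ℝ≥0, 0 < s ∧ (s : ℝ) < p.1 ∧ exRad (quadLoop p.1 p.2 s) = 0} :=
    measure_eq_zero_iff_ae_notMem.1 loopBase_exists_exRad_eq_zero
  filter_upwards [ae_fst_pos_loopBase, hax] with p hT hgood
  refine ⟨continuous_exPt.comp (continuous_quadLoop p.1 p.2), Real.toNNReal_pos.2 hT, by simp,
    by simp only [quadLoop_end hT, exPt_zero], fun s hs0 hsT ↦ ?_⟩
  rw [exPt_im]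
  refine exRad_pos fun h0 ↦ hgood ⟨s, hs0, ?_, h0⟩
  have : (s : ℝ) < ((p.1.toNNReal : ℝ≥0) : ℝ) := by exact_mod_cast hsT
  rwa [Real.coe_toNNReal _ hT.le] at this

/-! ### The Brownian bubble measure from the hitting masses of the lifted loop -/

/-- **The image of the loop measure under the bubble map is a Brownian bubble measure, given the
hitting masses**: if `loopBase{∃ s ≤ T, exPt (quadLoop T ω s) ∈ A} = starBubbleMass A` for
every `A ∈ 𝒬*`, the `Ω_b`-valued version of the bubble of the planar loop pushes `loopBase`
to a measure satisfying (7.2). [cite: LawlerSchrammWerner2003Restriction, §7.1 eq. (7.2) (p. 28)] -/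
theorem isBrownianBubbleMeasure_map_loopBase
    (hhit : ∀ ⦃A : Set ℂ⦄, IsStarHull A →
      loopBase {p : ℝ × WienerQuad | ∃ s ≤ p.1.toNNReal, exPt (quadLoop p.1 p.2 s) ∈ A} =
        ENNReal.ofReal (starBubbleMass A)) :
    ∃ Kb : ℝ × WienerQuad → BubbleConfig, Measurable Kb ∧
      (∀ᵐ p ∂loopBase, ∃ h : IsRootedLoop (fun s ↦ exPt (quadLoop p.1 p.2 s)) p.1.toNNReal, Kb p = h.bubble) ∧
        IsBrownianBubbleMeasure (loopBase.map Kb) := by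
  have hT : AEMeasurable (fun p : ℝ × WienerQuad ↦ p.1.toNNReal) loopBase :=
    (measurable_real_toNNReal.comp measurable_fst).aemeasurable
  have hmk : ∀ q : ℚ, AEMeasurable (fun p : ℝ × WienerQuad ↦ exPt (quadLoop p.1 p.2 ((q : ℝ).toNNReal))) loopBase :=
    fun q ↦ (measurable_exPt_quadLoop _).aemeasurable
  exact isBrownianBubbleMeasure_map_bubble (ν := loopBase) (B := fun p s ↦ exPt (quadLoop p.1 p.2 s))
    (T := fun p ↦ p.1.toNNReal) ae_isRootedLoop_loopBase hT hmk hhit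

/-- **The Brownian bubble measure exists as soon as the lifted Brownian loop hits each `A ∈ 𝒬*`
with mass `−SΦ_A(0)/6`**: [LSW] §7.1, the measure `μ = c Υ(T^{-1/2} n ⊗ P)` of filled Brownian
loops satisfies (7.2) — here with `T^{-1/2} n ⊗ P` realised as `loopBase` on `ℝ⁴`-valued loops
and the hitting identity for the PATH as the remaining input `hhit`.
[cite: LawlerSchrammWerner2003Restriction, §7.1 eqs. (7.1)–(7.2) (pp. 27–28)] -/
theorem exists_isBrownianBubbleMeasure_of_loopBase_hit
    (hhit : ∀ ⦃A : Set ℂ⦄, IsStarHull A →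
      loopBase {p : ℝ × WienerQuad | ∃ s ≤ p.1.toNNReal, exPt (quadLoop p.1 p.2 s) ∈ A} =
        ENNReal.ofReal (starBubbleMass A)) :
    exists_isBrownianBubbleMeasure := by
  obtain ⟨Kb, -, -, h⟩ := isBrownianBubbleMeasure_map_loopBase hhit
  exact ⟨_, h⟩

/-! ### [LSW] (7.2) for the lifted loop; the Brownian bubble measure exists -/

section Discharge

variable {A : Set ℂ}

/-- The lifted hull of a bounded set is bounded (`‖v‖ ≤ ‖exPt v‖`). [folklore] -/
theorem isBounded_preimage_exPt (hb : Bornology.IsBounded A) : Bornology.IsBounded (exPt ⁻¹' A) := by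
  obtain ⟨R, hR⟩ := hb.subset_closedBall 0
  refine (Metric.isBounded_closedBall (x := (0 : Fin 4 → ℝ)) (r := R)).subset fun v hv ↦ ?_
  rw [mem_closedBall, dist_zero_right]
  exact (norm_le_norm_exPt v).trans (by simpa using hR hv)

/-- **The two hit events agree**: the planar loop visits `A ∈ 𝒬*` at a time `≤ T` iff the lifted
loop visits `exPt⁻¹ A` at a time `< T` (`Process.LoopHits`), the loop being at `0 ∉ A` at the
times `0` and `T`. [folklore] -/
theorem setOf_exists_le_mem_eq_loopHits (hA : IsStarHull A) :
    {p : ℝ × WienerQuad | ∃ s ≤ p.1.toNNReal, exPt (quadLoop p.1 p.2 s) ∈ A} =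
      {p | LoopHits (exPt ⁻¹' A) p p.1} := by
  ext p
  constructor
  · rintro ⟨s, hs, hsA⟩
    have h0A : exPt (quadLoop p.1 p.2 s) ≠ 0 := fun h ↦ hA.zero_notMem (h ▸ hsA)
    rcases le_or_gt p.1 0 with hT | hT
    · exfalso
      have hs0 : s = 0 := le_antisymm (hs.trans (by simp [Real.toNNReal_of_nonpos hT])) zero_le
      apply h0A
      rw [hs0, quadLoop_zero, exPt_zero]
    · have hs' : (s : ℝ) ≤ p.1 := by
        have := NNReal.coe_le_coe.2 hs
        rwa [Real.coe_toNNReal _ hT.le] at this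
      refine ⟨s, lt_of_le_of_ne hs' fun heq ↦ h0A ?_, hsA⟩
      have hsT : s = p.1.toNNReal := NNReal.coe_injective (by rw [Real.coe_toNNReal _ hT.le]; exact heq)
      rw [hsT, quadLoop_end hT, exPt_zero]
  · rintro ⟨s, hs, hsA⟩
    have hT : 0 < p.1 := lt_of_le_of_lt s.coe_nonneg hs
    refine ⟨s, ?_, hsA⟩
    rw [← NNReal.coe_le_coe, Real.coe_toNNReal _ hT.le]
    exact hs.le

/-- **[LSW] (7.2) for the lifted Brownian loop**: `loopBase{∃ s ≤ T, exPt (quadLoop T ω s) ∈ A} =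
starBubbleMass A (= −SΦ_A(0)/6)` for every `A ∈ 𝒬*` — the loop measure hits the closed bounded
lifted hull `exPt⁻¹ A` (off the origin, `A` being off a ball about `0`) with mass
`E[𝟙{τ < ∞}|W_τ|⁻²]` (`Process.loopBase_loopHits_eq`), which is `starBubbleMass A`
(`lintegral_bubbleHit_eq`). [cite: LawlerSchrammWerner2003Restriction, §7.1 eq. (7.2) (p. 28)] -/
theorem loopBase_hit_eq_starBubbleMass (hA : IsStarHull A) :
    loopBase {p : ℝ × WienerQuad | ∃ s ≤ p.1.toNNReal, exPt (quadLoop p.1 p.2 s) ∈ A} =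
      ENNReal.ofReal (starBubbleMass A) := by
  rw [setOf_exists_le_mem_eq_loopHits hA]
  rcases A.eq_empty_or_nonempty with rfl | hne
  · have h1 : {p : ℝ × WienerQuad | LoopHits (exPt ⁻¹' (∅ : Set ℂ)) p p.1} = ∅ := by
      ext p
      simp only [mem_setOf_eq, mem_empty_iff_false, iff_false]
      rintro ⟨s, -, hs⟩
      exact hs
    rw [h1, measure_empty, starBubbleMass_empty, ENNReal.ofReal_zero]
  obtain ⟨r, hr0, hr⟩ := hA.exists_pos_disjoint_ball
  have hFδ : ∀ v ∈ exPt ⁻¹' A, r ^ 2 ≤ sqSum v := by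
    intro v hv
    have h1 : r ≤ ‖exPt v‖ := by
      by_contra h
      exact Set.disjoint_left.1 hr (mem_ball_zero_iff.2 (not_le.1 h)) hv
    rw [← normSq_exPt, normSq_exPt_eq]
    exact pow_le_pow_left₀ hr0.le h1 2
  rw [loopBase_loopHits_eq (isClosed_preimage_exPt hA.isBoundedHull.isClosed)
      (isBounded_preimage_exPt hA.isBoundedHull.1) hr0 hFδ,
    ← lintegral_bubbleHit_eq isBrownianVec_brownianQuad hA]
  refine lintegral_congr fun ω ↦ ?_
  by_cases h : IsBrownianVec.hitFrom brownianQuad (exPt ⁻¹' A) 0 ω ≠ ⊤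
  · rw [indicator_of_mem (show ω ∈ {ω | IsBrownianVec.hitFrom brownianQuad (exPt ⁻¹' A) 0 ω ≠ ⊤} from h),
      bubbleHit, indicator_of_mem (show ω ∈ {ω | IsBrownianVec.hitFrom brownianQuad (exPt ⁻¹' A) 0 ω ≠ ⊤} from h),
      IsBrownianVec.newtonR]
  · rw [indicator_of_notMem (show ω ∉ {ω | IsBrownianVec.hitFrom brownianQuad (exPt ⁻¹' A) 0 ω ≠ ⊤} from h),
      bubbleHit, indicator_of_notMem (show ω ∉ {ω | IsBrownianVec.hitFrom brownianQuad (exPt ⁻¹' A) 0 ω ≠ ⊤} from h),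
      ENNReal.ofReal_zero]

/-- **DISCHARGE of `exists_isBrownianBubbleMeasure`** ([LSW] §7.1, pp. 27–28: the Brownian bubble
measure at `0`, a measure on `Ω_b` with the hitting masses (7.2), exists — here realised, as in
the second bullet of §7.1 with §4 p. 16, as the law of the filling of the planar image
`L⁰ + i|L⃗|` of the Brownian loop at `0` in `ℝ⁴` under `𝟙_{T>0} dT/(2T²) ⊗ Wiener`).
[cite: LawlerSchrammWerner2003Restriction, §7.1 eqs. (7.1)–(7.2) (pp. 27–28)] -/
theorem exists_isBrownianBubbleMeasure_holds : exists_isBrownianBubbleMeasure :=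
  exists_isBrownianBubbleMeasure_of_loopBase_hit fun _ hA ↦ loopBase_hit_eq_starBubbleMass hA

/-- **The Brownian bubble measure, concretely**: the image of the loop measure `loopBase` under a
measurable `Ω_b`-valued map which is almost everywhere the bubble (filling) of the planar loop is
a Brownian bubble measure. [cite: LawlerSchrammWerner2003Restriction, §7.1 (pp. 27–28)] -/
theorem exists_isBrownianBubbleMeasure_map_loopBase :
    ∃ Kb : ℝ × WienerQuad → BubbleConfig, Measurable Kb ∧
      (∀ᵐ p ∂loopBase, ∃ h : IsRootedLoop (fun s ↦ exPt (quadLoop p.1 p.2 s)) p.1.toNNReal, Kb p = h.bubble) ∧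
        IsBrownianBubbleMeasure (loopBase.map Kb) :=
  isBrownianBubbleMeasure_map_loopBase fun _ hA ↦ loopBase_hit_eq_starBubbleMass hA

end Discharge

end Literature.Probability.RandomPlanarGeometry

end
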